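import Summits.Ventures.PercRepro.S1CFCapsFourTwo
import Summits.Ventures.PercRepro.S1CFGFour

/-!
# PercRepro — THE DEPENDENT `4`-SETS WITH AT MOST ONE DEPENDENT PAIR, ON `n ≥ 10` POINTS (p1, gen 38; stage 2 of the
cap `D₄` for every `n`)

The `12`-point theorems of S1CFCapsFourTwo (p1, gen 37) for every ground set of `n ≥ 10` points. For a loopless
coloop-free matroid of nullity `4`:
* **`ncard_dep_four_le_of_eq_zero`** — `D₂ = 0 ⇒ D₄ ≤ 16 · (n − 3) + 35` (`c₃ ≤ 16` by S1CFRelCover, `c₄ ≤ 35`);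
* **`ncard_dep_four_le_of_eq_one`** — `D₂ = 1 ⇒ D₄ ≤ C(n − 2, 2) + 14 · (n − 3) + 30`: a point `x` on a triangle
  carries `≤ 6` triangles and `≤ 20` `4`-circuits; the circuits avoiding `x` live in `E ∖ {x}`, of nullity `3`, and the
  lifting over the dependent pair `{a, a'}` (chosen with `x ∉ {a, a'}`) halves the count into `E ∖ {x, a'}`, of nullity
  `2`: `c₃ ≤ 6 + 2 · C(4, 3) = 14`, `c₄ ≤ 20 + 2 · C(5, 4) = 30`.
At `n = 12`: `179` and `201`. Nothing about any cell is claimed. Axioms: standard.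
-/

open scoped Matroid

namespace PercRepro

namespace S1CFG

open Set S1CF

variable {α : Type}

/-- **`D₂ = 0 ⇒ D₄ ≤ 16 · (n − 3) + 35`** (`n ≥ 10`). -/
theorem ncard_dep_four_le_of_eq_zero (M : Matroid α) [M.Finite] (hL : ∀ e ∈ M.E, ¬ M.IsLoop e)
    (hK : ∀ e, ¬ M.IsColoop e) (hd : M.E.encard = M.eRank + ((4 : ℕ) : ℕ∞)) (hn : 10 ≤ M.E.ncard)
    (h0 : {P : Set α | P ⊆ M.E ∧ P.ncard = 2 ∧ M.Dep P}.ncard = 0) :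
    {X : Set α | X ⊆ M.E ∧ X.ncard = 4 ∧ M.Dep X}.ncard ≤ 16 * (M.E.ncard - 3) + 35 := by
  have hs := ncard_dep_four_le_split_general M
  have h3 := ncard_triangles_le_sixteen M hL hK hd hn
  have h4 := ncard_fourCircuits_le_thirtyfive M hd
  have h3' : (M.E.ncard - 3) * {C : Set α | C ⊆ M.E ∧ M.IsCircuit C ∧ C.ncard = 3}.ncard ≤
      (M.E.ncard - 3) * 16 := Nat.mul_le_mul_left _ h3
  rw [h0] at hs
  omega

/-- **`D₂ = 1 ⇒ D₄ ≤ C(n − 2, 2) + 14 · (n − 3) + 30`** (`n ≥ 10`). -/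
theorem ncard_dep_four_le_of_eq_one (M : Matroid α) [M.Finite] (hL : ∀ e ∈ M.E, ¬ M.IsLoop e)
    (hK : ∀ e, ¬ M.IsColoop e) (hd : M.E.encard = M.eRank + ((4 : ℕ) : ℕ∞)) (hn : 10 ≤ M.E.ncard)
    (h1 : {P : Set α | P ⊆ M.E ∧ P.ncard = 2 ∧ M.Dep P}.ncard = 1) :
    {X : Set α | X ⊆ M.E ∧ X.ncard = 4 ∧ M.Dep X}.ncard ≤
      (M.E.ncard - 2).choose 2 + 14 * (M.E.ncard - 3) + 30 := by
  classical
  have hEfin := M.ground_finite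
  have hs := ncard_dep_four_le_split_general M
  rw [h1] at hs
  -- the dependent pair
  obtain ⟨P₀, hP₀⟩ : {P : Set α | P ⊆ M.E ∧ P.ncard = 2 ∧ M.Dep P}.Nonempty := by
    rw [← Set.ncard_pos (hEfin.finite_subsets.subset (fun P hP => hP.1))]; omega
  obtain ⟨hP₀E, hP₀2, hP₀dep⟩ := hP₀
  obtain ⟨a, a', haa', rfl⟩ := Set.ncard_eq_two.1 hP₀2
  have haE : a ∈ M.E := hP₀E (by simp)
  have ha'E : a' ∈ M.E := hP₀E (by simp)
  have ha'cl : a' ∈ M.closure {a} := mem_closure_singleton_of_dep_pair M haE (hL a haE) hP₀dep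
  -- no triangle: `D₄ ≤ C(n − 2, 2) + 35`
  rcases ({C : Set α | C ⊆ M.E ∧ M.IsCircuit C ∧ C.ncard = 3}).eq_empty_or_nonempty with hemp | ⟨T₀, hT₀⟩
  · have h3 : {C : Set α | C ⊆ M.E ∧ M.IsCircuit C ∧ C.ncard = 3}.ncard = 0 := by rw [hemp]; simp
    have h4 := ncard_fourCircuits_le_thirtyfive M hd
    rw [h3] at hs
    omega
  obtain ⟨hT₀E, hT₀c, hT₀3⟩ := hT₀
  -- a point of `T₀` outside `{a, a'}`
  obtain ⟨x, hxT₀, hxP⟩ : ∃ x ∈ T₀, x ∉ ({a, a'} : Set α) := by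
    by_contra h
    push Not at h
    have : T₀ ⊆ ({a, a'} : Set α) := fun w hw => h w hw
    have := Set.ncard_le_ncard this (Set.toFinite _)
    rw [Set.ncard_pair haa', hT₀3] at this
    omega
  have hx : x ∈ M.E := hT₀E hxT₀
  have hxa : x ≠ a := fun h => hxP (by rw [h]; simp)
  have hxa' : x ≠ a' := fun h => hxP (by rw [h]; simp)
  -- `E ∖ {x} ∖ {a'}` has nullity `2`
  have hY : M.E \ {x} ⊆ M.E := sdiff_subset
  have haY : a ∈ M.E \ {x} := ⟨haE, fun h => hxa (Set.mem_singleton_iff.1 h).symm⟩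
  have hY' : (M.E \ {x}) \ {a'} ⊆ M.E := sdiff_subset.trans sdiff_subset
  have hrkY' : M.eRk ((M.E \ {x}) \ {a'}) = M.eRk (M.E \ {x}) :=
    eRk_sdiff_singleton_eq_of_parallel M hY haY haa' ha'cl
  have hν' : ((M.E \ {x}) \ {a'}).ncard ≤ (M.eRk ((M.E \ {x}) \ {a'})).toNat + 2 := by
    have h3 := ncard_sdiff_singleton_le_eRk_toNat_add_three M hK hd hx
    have ha'Y : a' ∈ M.E \ {x} := ⟨ha'E, fun h => hxa' (Set.mem_singleton_iff.1 h).symm⟩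
    have hc := Set.ncard_sdiff_singleton_add_one ha'Y (hEfin.subset hY)
    rw [hrkY']
    omega
  -- the triangles: `≤ 6 + 2 · C(4, 3)`
  have hc3 : {C : Set α | C ⊆ M.E ∧ M.IsCircuit C ∧ C.ncard = 3}.ncard ≤ 14 := by
    have hsplit := ncard_isCircuit_le_through_add_sdiff M (x := x) 3
    have h6 := ncard_triangles_through_le_six M hL hK hd hn hx
    have hlift := ncard_isCircuit_le_two_mul_sdiff M hL haE ha'E haa' hP₀dep hY haY (k := 3) (by norm_num)
    have hin := ncard_isCircuit_ncard_eq_le M (ν := 2) (k := 3) (by norm_num) hY' hν'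
    norm_num at hin
    omega
  -- the `4`-circuits: `≤ 20 + 2 · C(5, 4)`
  have hc4 : {C : Set α | C ⊆ M.E ∧ M.IsCircuit C ∧ C.ncard = 4}.ncard ≤ 30 := by
    have hsplit := ncard_isCircuit_le_through_add_sdiff M (x := x) 4
    have h20 := ncard_fourCircuits_through_le_twenty M hL hd hx
    have hlift := ncard_isCircuit_le_two_mul_sdiff M hL haE ha'E haa' hP₀dep hY haY (k := 4) (by norm_num)
    have hin := ncard_isCircuit_ncard_eq_le M (ν := 2) (k := 4) (by norm_num) hY' hν'
    norm_num at hin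
    omega
  have hc3' : (M.E.ncard - 3) * {C : Set α | C ⊆ M.E ∧ M.IsCircuit C ∧ C.ncard = 3}.ncard ≤
      (M.E.ncard - 3) * 14 := Nat.mul_le_mul_left _ hc3
  omega

end S1CFG

end PercRepro
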